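import Mathlib
import HarnessLib
import Summits.HubbardSuperconductivity.HubbardSuperconductivity.Theorems.KLProgrammeKLRegimeTwoPointAssemblyDiag
import Summits.HubbardSuperconductivity.HubbardSuperconductivity.Theorems.KLProgrammeKLRegimeTwoPointAssemblyRepr
import Summits.HubbardSuperconductivity.HubbardSuperconductivity.Theorems.KLProgrammeKLRegimeTwoPointAssemblyFrame
import Summits.HubbardSuperconductivity.HubbardSuperconductivity.Theorems.KLProgrammeKLRegimeTwoPointAssemblyFree
import Summits.HubbardSuperconductivity.HubbardSuperconductivity.Theorems.KLProgrammeKLRegimeVolumeLimitDefs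
import Literature.MathematicalPhysics.QuantumLattice.HubbardCovarianceFrameResolvent
import Literature.MathematicalPhysics.QuantumLattice.HubbardScaleReport

/-!
# Child 5 `KLRegimeVolumeLimitV7` (stmt-HubbardSuperconductivity-19665) — the EXACT ZERO-COUPLING RUNG of the volume-limit text:
# `FinalTwoLegVolLimit β 0 μ K Mstar` for every `β > 0`, `μ`, frame `K`, thresholds `Mstar` (seat hubbard-kl-k3c5-p2)

At `U = 0` the interaction in the frame `K` is the quadratic counterterm alone, `V_K = 𝒩_K` (`hubbardInteraction … 0 = 0`), and the
fully integrated countertermed action `𝒢^K₀ = effAction C^K 𝒩_K` is computable in closed form WITHOUT opening the Gaussian calculus: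
the two-point identity of `…TwoPointAssemblyGrassmannRepr` (`∫dμ_{C^K} ψ⁺ψ⁻ e^{-V} = Z·(A_K + A_K ⊗ A_K · constPart ∂∂𝒢)`) applied to
`V = 𝒩_K`, whose left side the tree's counterterm measure change (`gaussExpect_hubbardCovarianceCT_counterterm_mul`: same model, frame
moved) evaluates as `Z_K · ⟨ψ⁺ψ⁻⟩_{bare}`, gives — after the collapse of the label sums (`…Diag`) —

  `ĝ_0(k) = ĝ_K(k) − ĝ_K(k)² Σ̂₀(k, σ)`,  i.e.  `Σ̂₀(k,σ) = K(p_k⃗)·(−iω + e_K(k⃗))/(−iω + ξ(k⃗))`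

(`ĝ_K = 1/(−iω + e_K)`, `ĝ_0 = 1/(−iω + ξ)`, `ξ = e_K + K`: the resummed counterterm insertion — the two-leg kernel of the effective action is
the amputated CONNECTED two-point function, `K/(1 + K ĝ_K)`, not the 1PI one, `K`).  By `klEffectiveAction_nScales_succ` this is the
carrier of the VL text, `klSelfEnergy L M β 0 μ K klE0 (nScales β + 1)`, so `FinalTwoLegVolLimit β 0 μ K Mstar` holds with the momentum-
continuous limit `Σ∞(n, p, σ) = K(p)(−iω_n + e_K(p))/(−iω_n + ξ(p))`, the uniform bound `‖K‖₀ (1 + ‖K‖₀ β/π)` and grid error EXACTLY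
`0` at every volume — the base case of every termwise / order-by-order rung of child 5 (plan g10 2026-08-26T16:19:44Z (2)), and a check
of the `selfEnergy` / frame normalisations read by child 4's `reprInt`.  Everything is proved; no definition.
-/

noncomputable section

namespace Summit.HubbardSuperconductivity.HubbardSuperconductivity.Theorems.TwoPointAssembly

set_option linter.dupNamespace false -- summit = problem name (single-conjunct summit), D-0017

open Finset Filter Literature.MathematicalPhysics.QuantumLattice Literature.Probability.LatticeModels GrassmannAlgebra
open Summit.HubbardSuperconductivity.HubbardSuperconductivity.Theorems.KLRegimeSplit
open Summit.HubbardSuperconductivity.HubbardSuperconductivity.Theorems.KLProgrammeLegKernels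

variable {L M : ℕ} [NeZero L]

/-! ## §1 The model at `U = 0` in the frame `K` -/

/-- At `U = 0` the fully integrated CT action is the effective action of the quadratic counterterm `𝒩_K` (the vertex vanishes:
`hubbardInteraction_zero_coupling`, `HubbardScaleReport`). -/
theorem fullActionCT_zero_coupling (β μ : ℝ) (K : TrigPolyC4v) :
    fullActionCT L M β 0 μ K = effAction ℂ (hubbardCovarianceCT L M β μ 0 K) (counterQuadratic L M β K) := by
  rw [fullActionCT, hubbardInteractionCT, hubbardInteraction_zero_coupling, zero_add]

/-- At `U = 0` the normalised partition function of the frame is the Gaussian normalisation `Z_K = ∫dμ_{C^K} e^{−𝒩_K} ≠ 0`. -/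
theorem effPartitionFn_zero_coupling_ne_zero {β : ℝ} (hβ : β ≠ 0) (μ : ℝ) (K : TrigPolyC4v) :
    effPartitionFn ℂ (hubbardCovarianceCT L M β μ 0 K) (hubbardInteractionCT L M β 0 K) ≠ 0 := by
  rw [hubbardInteractionCT, hubbardInteraction_zero_coupling, zero_add, effPartitionFn_eq_gaussExpect]
  exact gaussExpect_counterQuadratic_ne_zero β μ 0 K hβ

/-- The bare two-point function `⟨ψ̂⁺_{kσ} ψ̂⁻_{kσ}⟩₀ = −βL² ĝ_0(k)` (`ĝ_0 = propCT … 0 = 1/(−iω + ξ)`). -/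
theorem gaussExpect_hubbardCovariance_psiPlus_psiMinus {β : ℝ} (hβ : β ≠ 0) (μ : ℝ) (k : FreqMomentum L M) (σ : Fin 2) :
    gaussExpect ℂ (hubbardCovariance L M β μ 0)
        (gen ℂ (((k, σ), 0) : HubbardFieldIdx L M) * gen ℂ (((k, σ), 1) : HubbardFieldIdx L M)) =
      -(((β * (L : ℝ) ^ 2 : ℝ) : ℂ) * propCT L M β μ 0 k) := by
  rw [← hubbardCovarianceCT_zero_frame, gaussExpect_gen_mul_gen, ← contr_apply, contr_plus_minus hβ]

/-! ## §2 The two-leg kernel of `𝒢^K` at `U = 0` in closed form -/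

/-- **The resummed counterterm insertion**: at `U = 0`, for `β ≠ 0`,
`ĝ_0(k) = ĝ_K(k) − ĝ_K(k)² · Σ̂₀(k, σ)` with `Σ̂₀ = selfEnergy (fullActionCT … 0 …)`. -/
theorem propCT_zero_frame_eq_sub {β : ℝ} (hβ : β ≠ 0) (μ : ℝ) (K : TrigPolyC4v) (k : FreqMomentum L M) (σ : Fin 2) :
    propCT L M β μ 0 k =
      propCT L M β μ K k - propCT L M β μ K k ^ 2 * selfEnergy L M β (fullActionCT L M β 0 μ K) k σ := by
  have hβL : ((β * (L : ℝ) ^ 2 : ℝ) : ℂ) ≠ 0 := by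
    have hL : (L : ℝ) ≠ 0 := by exact_mod_cast NeZero.ne L
    exact_mod_cast mul_ne_zero hβ (pow_ne_zero 2 hL)
  set a : HubbardFieldIdx L M := ((k, σ), 0) with ha
  set b : HubbardFieldIdx L M := ((k, σ), 1) with hb
  have hZ := effPartitionFn_zero_coupling_ne_zero (L := L) (M := M) hβ μ K
  -- the generic two-point identity at `V = V_K(U = 0) = 𝒩_K`
  have hgen := gaussExpect_gen_mul_gen_mul_grassmannExp_neg ℂ (hubbardCovarianceCT L M β μ 0 K)
    (hubbardInteractionCT_mem_evenOdd_zero L M β 0 K) (constPart_hubbardInteractionCT L M β 0 K) (isUnit_iff_ne_zero.2 hZ) a b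
  -- its left side by the counterterm measure change: `Z_K · ⟨ψ⁺ψ⁻⟩_bare`
  have hN0 : grassmannExp (-(counterQuadratic L M β K)) ∈ evenOdd ℂ 0 :=
    grassmannExp_mem_evenOdd_zero ℂ (neg_mem (counterQuadratic_even L M β K))
      (isNilpotent_of_constPart_eq_zero ℂ (by rw [map_neg, constPart_counterQuadratic, neg_zero]))
  have hleft : gaussExpect ℂ (hubbardCovarianceCT L M β μ 0 K) (gen ℂ a * gen ℂ b * grassmannExp (-(hubbardInteractionCT L M β 0 K))) =
      effPartitionFn ℂ (hubbardCovarianceCT L M β μ 0 K) (hubbardInteractionCT L M β 0 K) *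
        -(((β * (L : ℝ) ^ 2 : ℝ) : ℂ) * propCT L M β μ 0 k) := by
    rw [hubbardInteractionCT, hubbardInteraction_zero_coupling, zero_add,
      ← (commute_of_mem_evenOdd_zero ℂ hN0 (gen ℂ a * gen ℂ b)).eq,
      gaussExpect_hubbardCovarianceCT_counterterm_mul L M μ 0 K hβ, effPartitionFn_eq_gaussExpect,
      gaussExpect_hubbardCovariance_psiPlus_psiMinus hβ]
  -- its right side: the label sums collapse to the diagonal
  have hinner : ∑ Y : HubbardFieldIdx L M, ∑ Z : HubbardFieldIdx L M,
      contr ℂ (hubbardCovarianceCT L M β μ 0 K) a Y * contr ℂ (hubbardCovarianceCT L M β μ 0 K) b Z *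
        constPart ℂ (grassmannDeriv ℂ Z (grassmannDeriv ℂ Y
          (effAction ℂ (hubbardCovarianceCT L M β μ 0 K) (hubbardInteractionCT L M β 0 K)))) =
      contr ℂ (hubbardCovarianceCT L M β μ 0 K) a b * contr ℂ (hubbardCovarianceCT L M β μ 0 K) b a *
        constPart ℂ (grassmannDeriv ℂ a (grassmannDeriv ℂ b (fullActionCT L M β 0 μ K))) := by
    rw [← fullActionCT]
    rw [Finset.sum_eq_single b]
    · rw [Finset.sum_eq_single a]
      · intro Z _ hZ'; rw [contr_minus_eq_zero β μ K k σ hZ', mul_zero, zero_mul]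
      · intro h; exact absurd (Finset.mem_univ _) h
    · intro Y _ hY
      exact Finset.sum_eq_zero fun Z _ => by rw [contr_plus_eq_zero β μ K k σ hY, zero_mul, zero_mul]
    · intro h; exact absurd (Finset.mem_univ _) h
  rw [hleft, hinner, contr_plus_minus hβ, contr_minus_plus hβ, constPart_dd_fullActionCT_eq hβ] at hgen
  have h := mul_left_cancel₀ hZ hgen
  -- `-(βL² ĝ₀) = -(βL² ĝ_K) + (-(βL² ĝ_K)) (βL² ĝ_K) (-(Σ̂/βL²))`
  set c : ℂ := ((β * (L : ℝ) ^ 2 : ℝ) : ℂ) with hc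
  have hcancel : -(c * propCT L M β μ K k) * (c * propCT L M β μ K k) *
      -(selfEnergy L M β (fullActionCT L M β 0 μ K) k σ / c) =
      c * (propCT L M β μ K k ^ 2 * selfEnergy L M β (fullActionCT L M β 0 μ K) k σ) := by
    field_simp
  rw [hcancel] at h
  refine mul_left_cancel₀ hβL ?_
  linear_combination -h

omit [NeZero L] in
/-- `ĝ_K(k) ≠ 0`. -/
theorem propCT_ne_zero {β : ℝ} (hβ : β ≠ 0) (μ : ℝ) (K : TrigPolyC4v) (k : FreqMomentum L M) : propCT L M β μ K k ≠ 0 := by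
  rw [propCT, one_div]
  refine inv_ne_zero fun h => ?_
  have := congrArg Complex.im h
  simp at this
  exact matsubaraFreq_ne_zero hβ k.1 this

omit [NeZero L] in
/-- `−iω + ξ ≠ 0` for a fermionic Matsubara frequency (any real band value). -/
theorem neg_I_mul_matsubaraFreq_add_ne_zero {β : ℝ} (hβ : β ≠ 0) (i : MatsubaraIdx M) (x : ℝ) :
    -Complex.I * (matsubaraFreq β M i : ℂ) + (x : ℂ) ≠ 0 := by
  intro h
  have := congrArg Complex.im h
  simp at this
  exact matsubaraFreq_ne_zero hβ i this

/-- **The two-leg kernel of `𝒢^K` at `U = 0` in closed form**: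
`Σ̂₀(k, σ) = K(p_k⃗) · (−iω + e_K(k⃗)) / (−iω + ξ(k⃗))` (`ξ = nambuXiCT … 0 = e_K + K(p)`). -/
theorem selfEnergy_fullActionCT_zero_coupling {β : ℝ} (hβ : β ≠ 0) (μ : ℝ) (K : TrigPolyC4v) (k : FreqMomentum L M) (σ : Fin 2) :
    selfEnergy L M β (fullActionCT L M β 0 μ K) k σ =
      (K.eval (latticeMomentum L k.2) : ℂ) * (-Complex.I * (matsubaraFreq β M k.1 : ℂ) + (nambuXiCT L μ K k.2 : ℂ)) /
        (-Complex.I * (matsubaraFreq β M k.1 : ℂ) + (nambuXiCT L μ 0 k.2 : ℂ)) := by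
  have h := propCT_zero_frame_eq_sub hβ μ K k σ
  have hDK := neg_I_mul_matsubaraFreq_add_ne_zero (M := M) hβ k.1 (nambuXiCT L μ K k.2)
  have hD0 := neg_I_mul_matsubaraFreq_add_ne_zero (M := M) hβ k.1 (nambuXiCT L μ 0 k.2)
  have hξ : (nambuXiCT L μ 0 k.2 : ℂ) = (nambuXiCT L μ K k.2 : ℂ) + (K.eval (latticeMomentum L k.2) : ℂ) := by
    rw [nambuXiCT_zero_frame, nambuXi_eq_nambuXiCT_add L μ K k.2, Complex.ofReal_add]
  set S : ℂ := selfEnergy L M β (fullActionCT L M β 0 μ K) k σ with hS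
  set DK : ℂ := -Complex.I * (matsubaraFreq β M k.1 : ℂ) + (nambuXiCT L μ K k.2 : ℂ) with hDKdef
  set D0 : ℂ := -Complex.I * (matsubaraFreq β M k.1 : ℂ) + (nambuXiCT L μ 0 k.2 : ℂ) with hD0def
  set Kp : ℂ := (K.eval (latticeMomentum L k.2) : ℂ) with hKp
  have hD : D0 = DK + Kp := by rw [hD0def, hDKdef, hξ]; ring
  have hpK : propCT L M β μ K k = 1 / DK := rfl
  have hp0 : propCT L M β μ 0 k = 1 / D0 := rfl
  rw [hpK, hp0] at h
  have e1 : (1 : ℂ) / D0 * (DK ^ 2 * D0) = DK ^ 2 := by field_simp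
  have e2 : (1 / DK - (1 / DK) ^ 2 * S) * (DK ^ 2 * D0) = DK * D0 - S * D0 := by
    field_simp
  have e3 : DK ^ 2 = DK * D0 - S * D0 := by
    calc DK ^ 2 = (1 : ℂ) / D0 * (DK ^ 2 * D0) := e1.symm
      _ = (1 / DK - (1 / DK) ^ 2 * S) * (DK ^ 2 * D0) := by rw [← h]
      _ = DK * D0 - S * D0 := e2
  rw [eq_div_iff hD0]
  linear_combination e3 + DK * hD

/-! ## §3 The carrier of the VL text at `U = 0` -/

/-- At `U = 0` the last-index two-leg vertex function of the KL ladder IS the closed form above (`β > 0`). -/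
theorem klSelfEnergy_nScales_succ_zero_coupling {β : ℝ} (hβ : 0 < β) (μ : ℝ) (K : TrigPolyC4v) (k : FreqMomentum L M)
    (σ : Fin 2) :
    klSelfEnergy L M β 0 μ K klE0 (nScales β + 1) k σ =
      (K.eval (latticeMomentum L k.2) : ℂ) * (-Complex.I * (matsubaraFreq β M k.1 : ℂ) + (nambuXiCT L μ K k.2 : ℂ)) /
        (-Complex.I * (matsubaraFreq β M k.1 : ℂ) + (nambuXiCT L μ 0 k.2 : ℂ)) := by
  rw [klSelfEnergy, klEffectiveAction_nScales_succ L M hβ, ← fullActionCT, selfEnergy_fullActionCT_zero_coupling hβ.ne']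

/-- **Uniform bound** of the closed form: `|K(p)(−iω + e_K)/(−iω + ξ)| ≤ ‖K‖₀ (1 + ‖K‖₀ β/π)` (`|ω| ≥ π/β`, `ξ − e_K = K(p)`). -/
theorem norm_closedForm_le {β : ℝ} (hβ : 0 < β) (μ : ℝ) (K : TrigPolyC4v) (ω : ℝ) (hω : Real.pi / β ≤ |ω|) (p : Fin 2 → ℝ) :
    ‖(K.eval p : ℂ) * (-Complex.I * (ω : ℂ) + ((-2 * ∑ i, Real.cos (p i) - μ - K.eval p : ℝ) : ℂ)) /
        (-Complex.I * (ω : ℂ) + ((-2 * ∑ i, Real.cos (p i) - μ : ℝ) : ℂ))‖ ≤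
      K.coeffNorm 0 * (1 + K.coeffNorm 0 * (β / Real.pi)) := by
  have hπβ : 0 < Real.pi / β := div_pos Real.pi_pos hβ
  have hω0 : 0 < |ω| := lt_of_lt_of_le hπβ hω
  set D : ℂ := -Complex.I * (ω : ℂ) + ((-2 * ∑ i, Real.cos (p i) - μ : ℝ) : ℂ) with hD
  have hDim : D.im = -ω := by simp [hD]
  have hDnorm : |ω| ≤ ‖D‖ := by
    calc |ω| = |D.im| := by rw [hDim, abs_neg]
      _ ≤ ‖D‖ := Complex.abs_im_le_norm D
  have hDne : D ≠ 0 := fun h => by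
    rw [h, norm_zero] at hDnorm
    linarith
  have hnum : (-Complex.I * (ω : ℂ) + ((-2 * ∑ i, Real.cos (p i) - μ - K.eval p : ℝ) : ℂ)) = D - (K.eval p : ℂ) := by
    rw [hD]; push_cast; ring
  rw [hnum, mul_div_assoc, sub_div, div_self hDne, norm_mul, Complex.norm_real, Real.norm_eq_abs]
  have hK := TrigPolyC4v.abs_eval_le_coeffNorm K p
  have hK0 : 0 ≤ K.coeffNorm 0 := TrigPolyC4v.coeffNorm_nonneg 0 K
  have h2 : ‖(1 : ℂ) - (K.eval p : ℂ) / D‖ ≤ 1 + K.coeffNorm 0 * (β / Real.pi) := by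
    calc ‖(1 : ℂ) - (K.eval p : ℂ) / D‖ ≤ ‖(1 : ℂ)‖ + ‖(K.eval p : ℂ) / D‖ := norm_sub_le _ _
      _ = 1 + |K.eval p| / ‖D‖ := by rw [norm_one, norm_div, Complex.norm_real, Real.norm_eq_abs]
      _ ≤ 1 + K.coeffNorm 0 * (β / Real.pi) := by
        gcongr 1 + ?_
        rw [div_le_iff₀ (lt_of_lt_of_le hω0 hDnorm)]
        calc |K.eval p| ≤ K.coeffNorm 0 * 1 := by rw [mul_one]; exact hK
          _ = K.coeffNorm 0 * (β / Real.pi) * (Real.pi / β) := by field_simp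
          _ ≤ K.coeffNorm 0 * (β / Real.pi) * ‖D‖ := by
            gcongr
            exact hω.trans hDnorm
  calc |K.eval p| * ‖(1 : ℂ) - (K.eval p : ℂ) / D‖ ≤ K.coeffNorm 0 * (1 + K.coeffNorm 0 * (β / Real.pi)) := by
        gcongr
  _ = _ := rfl

/-! ## §4 The volume-limit text at zero coupling -/

/-- The Matsubara frequency of a label of integer `n` is `π(2n+1)/β`. -/
theorem matsubaraFreq_of_matsubaraInt_eq (β : ℝ) {M : ℕ} {i : MatsubaraIdx M} {n : ℤ} (h : matsubaraInt M i = n) :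
    matsubaraFreq β M i = Real.pi * (2 * (n : ℝ) + 1) / β := by
  rw [matsubaraFreq, h]

/-- **THE ZERO-COUPLING RUNG**: `FinalTwoLegVolLimit β 0 μ K Mstar` for every `β > 0`, `μ`, frame `K` and thresholds `Mstar`, with
`Σ∞(n, p, σ) = K(p)(−iω_n + e_K(p))/(−iω_n + ξ(p))`, `ω_n = π(2n+1)/β`. -/
theorem finalTwoLegVolLimit_zero_coupling {β : ℝ} (hβ : 0 < β) (μ : ℝ) (K : TrigPolyC4v) (Mstar : ℕ → ℕ) :
    FinalTwoLegVolLimit β 0 μ K Mstar := by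
  set ωn : ℤ → ℝ := fun n => Real.pi * (2 * (n : ℝ) + 1) / β with hωn
  refine ⟨fun n p _ => (K.eval p : ℂ) * (-Complex.I * (ωn n : ℂ) + ((-2 * ∑ i, Real.cos (p i) - μ - K.eval p : ℝ) : ℂ)) /
      (-Complex.I * (ωn n : ℂ) + ((-2 * ∑ i, Real.cos (p i) - μ : ℝ) : ℂ)),
    K.coeffNorm 0 * (1 + K.coeffNorm 0 * (β / Real.pi)), 0, ?_, ?_, ?_⟩
  · -- continuity in the momentum
    intro n σ
    have hωn_abs : Real.pi / β ≤ |ωn n| := by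
      rw [hωn]; dsimp only
      rw [abs_div, abs_of_pos hβ, abs_mul, abs_of_pos Real.pi_pos]
      exact div_le_div_of_nonneg_right (le_mul_of_one_le_right Real.pi_pos.le (one_le_abs_two_mul_add_one n)) hβ.le
    have hden : ∀ p : Fin 2 → ℝ, -Complex.I * (ωn n : ℂ) + ((-2 * ∑ i, Real.cos (p i) - μ : ℝ) : ℂ) ≠ 0 := by
      intro p h
      have := congrArg Complex.im h
      simp at this
      have hπβ : 0 < Real.pi / β := div_pos Real.pi_pos hβ
      rw [this, abs_zero] at hωn_abs
      linarith
    have hcos : Continuous fun p : Fin 2 → ℝ => -2 * ∑ i, Real.cos (p i) - μ :=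
      ((continuous_const.mul (continuous_finsetSum _ fun i _ =>
        Real.continuous_cos.comp (continuous_apply i))).sub continuous_const)
    have hK : Continuous fun p : Fin 2 → ℝ => K.eval p := TrigPolyC4v.continuous_eval K
    refine Continuous.div ?_ ?_ hden
    · exact (Complex.continuous_ofReal.comp hK).mul
        (continuous_const.add (Complex.continuous_ofReal.comp (hcos.sub hK)))
    · exact continuous_const.add (Complex.continuous_ofReal.comp hcos)
  · -- the uniform bound, at every volume beyond `L₀ = 0`
    intro L _ _ M' _ _ k σ
    rw [klSelfEnergy_nScales_succ_zero_coupling hβ]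
    have hb := norm_closedForm_le hβ μ K (matsubaraFreq β M' k.1) (pi_div_le_abs_matsubaraFreq hβ k.1)
      (latticeMomentum L k.2)
    have e1 : (nambuXiCT L μ K k.2 : ℝ) = -2 * ∑ i, Real.cos (latticeMomentum L k.2 i) - μ - K.eval (latticeMomentum L k.2) := by
      rw [nambuXiCT, torusBand]
    have e0 : (nambuXiCT L μ 0 k.2 : ℝ) = -2 * ∑ i, Real.cos (latticeMomentum L k.2 i) - μ := by
      rw [nambuXiCT_zero_frame, nambuXi, torusBand]
    rw [e1, e0]
    exact hb
  · -- grid convergence: the error is exactly `0`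
    intro n σ ε hε
    refine ⟨0, fun L _ _ => ⟨0, fun M' _ _ ω hω k => ?_⟩⟩
    rw [klSelfEnergy_nScales_succ_zero_coupling hβ, matsubaraFreq_of_matsubaraInt_eq β hω]
    have e1 : (nambuXiCT L μ K k : ℝ) = -2 * ∑ i, Real.cos (latticeMomentum L k i) - μ - K.eval (latticeMomentum L k) := by
      rw [nambuXiCT, torusBand]
    have e0 : (nambuXiCT L μ 0 k : ℝ) = -2 * ∑ i, Real.cos (latticeMomentum L k i) - μ := by
      rw [nambuXiCT_zero_frame, nambuXi, torusBand]
    rw [e1, e0, hωn]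
    simp only [sub_self, norm_zero]
    exact hε.le

end Summit.HubbardSuperconductivity.HubbardSuperconductivity.Theorems.TwoPointAssembly

end
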